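import Summits.RiemannHypothesis.RiemannHypothesis.Theorems.NbSectionTwoDyadicPairing
import Summits.RiemannHypothesis.RiemannHypothesis.Theorems.NbSectionTwoDyadicStepForm
import Literature.NumberTheory.LFunctions.LittlewoodCriterion
import Literature.Barriers.RiemannHypothesis.TuranPartialSums
import HarnessLib

/-!
# Route NbSectionZeroLaw — the STEP SPACE of finite Dirichlet polynomials (support for item
# stmt-RiemannHypothesis-23096 `IntrinsicDualBound`)

For a finite Dirichlet polynomial `D(s) = Σ_{n ∈ [1,L]} c_n n^{-s}` write `S_k = Σ_{n ≤ k} c_n` for its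
coefficient partial sums (constant `= S_L` from `k = L` on when `c` vanishes beyond `L`) and
`w_k = 1/(k(k+1))`.  This file proves the three facts that make the Nyman–Beurling distance on the
critical line a DISCRETE least-squares problem in `ℓ²(w)` («step space»; Báez-Duarte's `d_N` in the
Mellin–Plancherel picture `n^{-s}/s ↔ χ_(0,1/n]`):

* §1 `step_isometry` — `∫ |D(1/2+it)|² dt/(1/4+t²) = 2π (Σ_{k<L} w_k |S_k|² + |S_L|²/L)`, assembled
  from the sibling toolkit (`NbSectionTwo.integral_norm_sq_sum_cpow_div`: Gram expansion with the
  pairing kernel `2π/max(m,n)`; `NbSectionTwo.sum_sum_div_max_eq`: the Abel step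
  `1/max(m,n) = Σ_{k ≥ max} w_k`), and its `ℓ²(w)` form `tsum_weight_norm_sq`
  (`Σ_{k ≥ 1} w_k |S_k|² = Σ_{k<L} w_k|S_k|² + |S_L|²/L`, tail `Σ_{k ≥ L} w_k = 1/L`);
* §2 `abel_range`, `hasSum_eval` — the EVALUATION IDENTITY
  `D(ρ) = Σ_{k ≥ 1} S_k (k^{-ρ} − (k+1)^{-ρ})` for `Re ρ > 0` (Abel summation; the tail telescopes),
  i.e. `D(ρ)/ρ = ⟨S, r_ρ⟩_w` with the representer `r_ρ(k) = k(k+1)·conj(k^{-ρ} − (k+1)^{-ρ})/conj ρ`;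
* §3 `section_coeff_sum_cpow` — the coefficients of `1 − ζ_M(s) A_a(s)` (`A_a(s) = Σ_{j<N} a_j
  (j+1)^{-s}`) as such a polynomial of length `M N + 1`.

No definitions (all objects are spelled out); RH-free; standard axioms.  References: L. Báez-Duarte,
Rend. Lincei 14 (2003) 5–11; L. Báez-Duarte, M. Balazard, B. Landreau, E. Saias, Adv. Math. 149
(2000) §1; A. Ghosh, K. Kremnitzer, W. Noor, C. F. Santos, arXiv:2206.00434 (the weighted space
`ℓ²_ω`, `ω_n = 1/((n+1)(n+2))`).  No summit is proved by this file; nothing here bears on the truth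
of RH.
-/

noncomputable section

-- D-0017: `Summit.<S>.<S>.…` is the designed namespace of a single-problem summit.
set_option linter.dupNamespace false

open scoped Real ComplexConjugate Topology
open MeasureTheory Complex Finset Filter

namespace Summit.RiemannHypothesis.RiemannHypothesis.Theorems.NbSectionZeroLaw

open Literature.Barriers.RiemannHypothesis
open Summit.RiemannHypothesis.RiemannHypothesis.Theorems.NbSectionTwo

/-! ## §1 — The step isometry -/

/-- **Step isometry (finite form).** For every `L` and coefficients `c`,
`∫ ‖Σ_{n∈[1,L]} c_n n^{-(1/2+it)}‖² dt/(1/4+t²) = 2π (Σ_{k∈[1,L)} ‖S_k‖²/(k(k+1)) + ‖S_L‖²/L)`,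
`S_k = Σ_{n ≤ k} c_n`. [cite: BaezDuarte2003, §1 (the distance `d_N`)] -/
theorem step_isometry (L : ℕ) (c : ℕ → ℂ) :
    ∫ t : ℝ, ‖∑ n ∈ Icc 1 L, c n * (n : ℂ) ^ (-(1 / 2 + t * I))‖ ^ 2 / (1 / 4 + t ^ 2) =
      2 * π * (∑ k ∈ Ico 1 L, ‖∑ n ∈ Icc 1 k, c n‖ ^ 2 / ((k : ℝ) * (k + 1)) +
        ‖∑ n ∈ Icc 1 L, c n‖ ^ 2 / L) := by
  have hS : ∀ m ∈ Icc 1 L, m ≠ 0 := fun m hm ↦ by rw [Finset.mem_Icc] at hm; omega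
  rw [integral_norm_sq_sum_cpow_div _ hS c]
  have hx : ∀ m n : ℕ, (c m * conj (c n)).re * (2 * π / ((max m n : ℕ) : ℝ)) =
      ((c m * conj (c n)).re * (2 * π)) / ((max m n : ℕ) : ℝ) := fun m n ↦ by ring
  simp_rw [hx]
  rw [sum_sum_div_max_eq L (fun m n ↦ (c m * conj (c n)).re * (2 * π))]
  have hk : ∀ k : ℕ, ∑ m ∈ Icc 1 k, ∑ n ∈ Icc 1 k, (c m * conj (c n)).re * (2 * π) =
      2 * π * ‖∑ n ∈ Icc 1 k, c n‖ ^ 2 := by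
    intro k
    rw [norm_sq_sum_eq_sum_sum_re]
    simp only [Finset.mul_sum]
    refine Finset.sum_congr rfl fun m _ ↦ ?_
    refine Finset.sum_congr rfl fun n _ ↦ ?_
    ring
  simp_rw [hk]
  rw [mul_add, Finset.mul_sum]
  congr 1
  · refine Finset.sum_congr rfl fun k _ ↦ ?_
    ring
  · ring

/-- The same as an `ENNReal.ofReal` identity for the Báez-Duarte lintegral. [folklore] -/
theorem step_isometry_lintegral (L : ℕ) (c : ℕ → ℂ) :
    ∫⁻ t : ℝ, ENNReal.ofReal (‖∑ n ∈ Icc 1 L, c n * (n : ℂ) ^ (-(1 / 2 + t * I))‖ ^ 2 /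
        (1 / 4 + t ^ 2)) =
      ENNReal.ofReal (2 * π * (∑ k ∈ Ico 1 L, ‖∑ n ∈ Icc 1 k, c n‖ ^ 2 / ((k : ℝ) * (k + 1)) +
        ‖∑ n ∈ Icc 1 L, c n‖ ^ 2 / L)) := by
  have hS : ∀ m ∈ Icc 1 L, m ≠ 0 := fun m hm ↦ by rw [Finset.mem_Icc] at hm; omega
  rw [← step_isometry L c, ← ofReal_integral_eq_lintegral_ofReal
    (integrable_norm_sq_sum_cpow_div _ hS c) (Eventually.of_forall fun t ↦ by positivity)]

/-- Partial sums are constant beyond the support: if `c_n = 0` for `n > L` then `S_k = S_L` for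
`k ≥ L`. [folklore] -/
theorem partialSum_eq_of_le {c : ℕ → ℂ} {L : ℕ} (hc : ∀ n, L < n → c n = 0) {k : ℕ} (hk : L ≤ k) :
    ∑ n ∈ Icc 1 k, c n = ∑ n ∈ Icc 1 L, c n := by
  refine (Finset.sum_subset (Finset.Icc_subset_Icc_right hk) fun n hn hn' ↦ ?_).symm
  rw [Finset.mem_Icc] at hn hn'
  exact hc n (by omega)

/-- The Dirichlet polynomial is unchanged by extending the range beyond the support. [folklore] -/
theorem dirichlet_eq_of_le {c : ℕ → ℂ} {L : ℕ} (hc : ∀ n, L < n → c n = 0) {k : ℕ} (hk : L ≤ k)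
    (ρ : ℂ) :
    ∑ n ∈ Icc 1 k, c n * (n : ℂ) ^ (-ρ) = ∑ n ∈ Icc 1 L, c n * (n : ℂ) ^ (-ρ) := by
  refine (Finset.sum_subset (Finset.Icc_subset_Icc_right hk) fun n hn hn' ↦ ?_).symm
  rw [Finset.mem_Icc] at hn hn'
  rw [hc n (by omega), zero_mul]

/-- All partial sums are bounded by `Σ_{n ≤ L} ‖c_n‖`. [folklore] -/
theorem norm_partialSum_le {c : ℕ → ℂ} {L : ℕ} (hc : ∀ n, L < n → c n = 0) (k : ℕ) :
    ‖∑ n ∈ Icc 1 k, c n‖ ≤ ∑ n ∈ Icc 1 L, ‖c n‖ := by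
  rcases le_or_gt L k with hk | hk
  · rw [partialSum_eq_of_le hc hk]
    exact norm_sum_le _ _
  · calc ‖∑ n ∈ Icc 1 k, c n‖ ≤ ∑ n ∈ Icc 1 k, ‖c n‖ := norm_sum_le _ _
      _ ≤ ∑ n ∈ Icc 1 L, ‖c n‖ :=
          Finset.sum_le_sum_of_subset_of_nonneg (Finset.Icc_subset_Icc_right hk.le)
            fun n _ _ ↦ norm_nonneg _

/-- The tail of the weights: `Σ_{j ≥ 0} 1/((j+L)(j+L+1)) = 1/L` for `L ≥ 1` (telescoping).
[folklore] -/
theorem hasSum_weight_tail {L : ℕ} (hL : 1 ≤ L) :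
    HasSum (fun j : ℕ ↦ 1 / (((j : ℝ) + L) * ((j : ℝ) + L + 1))) (1 / (L : ℝ)) := by
  have hL0 : (0 : ℝ) < L := by exact_mod_cast hL
  have hpart : ∀ K : ℕ, ∑ j ∈ Finset.range K, 1 / (((j : ℝ) + L) * ((j : ℝ) + L + 1)) =
      1 / (L : ℝ) - 1 / ((K : ℝ) + L) := by
    intro K
    induction K with
    | zero => simp
    | succ K ih =>
      rw [Finset.sum_range_succ, ih]
      have h1 : (0 : ℝ) < (K : ℝ) + L := by positivity
      have h2 : (0 : ℝ) < (K : ℝ) + L + 1 := by positivity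
      have h3 : (0 : ℝ) < (K : ℝ) + 1 + L := by positivity
      push_cast
      field_simp
      ring
  rw [hasSum_iff_tendsto_nat_of_nonneg (fun j ↦ by positivity)]
  simp_rw [hpart]
  have h0 : Tendsto (fun K : ℕ ↦ 1 / ((K : ℝ) + L)) atTop (𝓝 0) := by
    have h : Tendsto (fun K : ℕ ↦ (K : ℝ) + L) atTop atTop :=
      tendsto_atTop_add_const_right _ _ tendsto_natCast_atTop_atTop
    rw [show (fun K : ℕ ↦ 1 / ((K : ℝ) + L)) = (fun K : ℕ ↦ (K : ℝ) + L)⁻¹ from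
      funext fun K ↦ by simp [one_div]]
    exact h.inv_tendsto_atTop
  simpa using (tendsto_const_nhds (x := 1 / (L : ℝ))).sub h0

/-- **Step isometry (`ℓ²(w)` form).** If `c` vanishes beyond `L ≥ 1`, then
`Σ_{m ≥ 0} ‖S_{m+1}‖²/((m+1)(m+2)) = Σ_{k∈[1,L)} ‖S_k‖²/(k(k+1)) + ‖S_L‖²/L` (as a `HasSum`).
[cite: BaezDuarte2003, §1] -/
theorem hasSum_weight_norm_sq {c : ℕ → ℂ} {L : ℕ} (hL : 1 ≤ L) (hc : ∀ n, L < n → c n = 0) :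
    HasSum (fun m : ℕ ↦ ‖∑ n ∈ Icc 1 (m + 1), c n‖ ^ 2 / (((m : ℝ) + 1) * ((m : ℝ) + 2)))
      (∑ k ∈ Ico 1 L, ‖∑ n ∈ Icc 1 k, c n‖ ^ 2 / ((k : ℝ) * (k + 1)) +
        ‖∑ n ∈ Icc 1 L, c n‖ ^ 2 / L) := by
  set f : ℕ → ℝ := fun m ↦ ‖∑ n ∈ Icc 1 (m + 1), c n‖ ^ 2 / (((m : ℝ) + 1) * ((m : ℝ) + 2))
    with hf
  -- the tail from `m = L - 1` on: `S_{m+1} = S_L`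
  have htail : HasSum (fun j : ℕ ↦ f (j + (L - 1)))
      (‖∑ n ∈ Icc 1 L, c n‖ ^ 2 * (1 / (L : ℝ))) := by
    have h := (hasSum_weight_tail hL).mul_left (‖∑ n ∈ Icc 1 L, c n‖ ^ 2)
    refine h.congr_fun fun j ↦ ?_
    rw [hf]
    dsimp only
    rw [partialSum_eq_of_le hc (by omega)]
    have : ((j + (L - 1) : ℕ) : ℝ) = (j : ℝ) + L - 1 := by
      rw [Nat.cast_add, Nat.cast_sub hL]; push_cast; ring
    rw [this]
    ring
  -- the head `m < L - 1`, i.e. `k = m + 1 ∈ [1, L)`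
  have hhead : ∑ m ∈ Finset.range (L - 1), f m =
      ∑ k ∈ Ico 1 L, ‖∑ n ∈ Icc 1 k, c n‖ ^ 2 / ((k : ℝ) * (k + 1)) := by
    rw [Finset.sum_Ico_eq_sum_range]
    refine Finset.sum_congr rfl fun m _ ↦ ?_
    rw [hf]
    dsimp only
    rw [add_comm 1 m]
    push_cast
    ring
  have key : HasSum (fun n ↦ f (n + (L - 1)))
      ((∑ k ∈ Ico 1 L, ‖∑ n ∈ Icc 1 k, c n‖ ^ 2 / ((k : ℝ) * (k + 1)) +
        ‖∑ n ∈ Icc 1 L, c n‖ ^ 2 / L) - ∑ i ∈ Finset.range (L - 1), f i) := by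
    rw [hhead, add_sub_cancel_left, div_eq_mul_one_div]
    exact htail
  exact (hasSum_nat_add_iff' (L - 1)).mp key

/-! ## §2 — Abel summation and the evaluation identity -/

/-- **Abel summation, finite form.** For all `c`, `ρ`, `K`:
`Σ_{m<K} S_{m+1} ((m+1)^{-ρ} − (m+2)^{-ρ}) = Σ_{n∈[1,K]} c_n n^{-ρ} − S_K (K+1)^{-ρ}`. [folklore] -/
theorem abel_range (c : ℕ → ℂ) (ρ : ℂ) (K : ℕ) :
    ∑ m ∈ Finset.range K, (∑ n ∈ Icc 1 (m + 1), c n) *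
        (((m : ℂ) + 1) ^ (-ρ) - ((m : ℂ) + 2) ^ (-ρ)) =
      ∑ n ∈ Icc 1 K, c n * (n : ℂ) ^ (-ρ) - (∑ n ∈ Icc 1 K, c n) * ((K : ℂ) + 1) ^ (-ρ) := by
  induction K with
  | zero => simp
  | succ K ih =>
    rw [Finset.sum_range_succ, ih, Finset.sum_Icc_succ_top (by omega),
      Finset.sum_Icc_succ_top (by omega)]
    push_cast
    ring

/-- Mean-value bound `‖(m+1)^{-ρ} − (m+2)^{-ρ}‖ ≤ ‖ρ‖ (m+1)^{-Re ρ - 1}` (`Re ρ > 0`). [folklore] -/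
theorem norm_cpow_succ_sub_le (m : ℕ) {ρ : ℂ} (hρ : 0 < ρ.re) :
    ‖((m : ℂ) + 1) ^ (-ρ) - ((m : ℂ) + 2) ^ (-ρ)‖ ≤ ‖ρ‖ * ((m : ℝ) + 1) ^ (-ρ.re - 1) := by
  have h := Literature.NumberTheory.LFunctions.MertensDictionary.norm_cpow_neg_sub_le
    (n := m + 1) (by omega) hρ
  have e1 : (((m + 1 : ℕ) : ℕ) : ℂ) = (m : ℂ) + 1 := by push_cast; ring
  have e2 : (((m + 1 + 1 : ℕ) : ℕ) : ℂ) = (m : ℂ) + 2 := by push_cast; ring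
  have e3 : (((m + 1 : ℕ) : ℕ) : ℝ) = (m : ℝ) + 1 := by push_cast; ring
  rw [e1, e2, e3] at h
  exact h

/-- `Σ_m (m+1)^{-q}` converges for `q > 1`. [folklore] -/
theorem summable_nat_add_one_rpow_neg {q : ℝ} (hq : 1 < q) :
    Summable fun m : ℕ ↦ ((m : ℝ) + 1) ^ (-q) := by
  have h := (Real.summable_one_div_nat_add_rpow 1 q).mpr hq
  refine h.congr fun m ↦ ?_
  have hm : (0 : ℝ) < (m : ℝ) + 1 := by positivity
  rw [abs_of_pos hm, Real.rpow_neg hm.le, one_div]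

/-- The Abel terms `S_{m+1}((m+1)^{-ρ} − (m+2)^{-ρ})` are absolutely summable when `c` has finite
support and `Re ρ > 0`. [folklore] -/
theorem summable_norm_abel_term {c : ℕ → ℂ} {L : ℕ} (hc : ∀ n, L < n → c n = 0) {ρ : ℂ}
    (hρ : 0 < ρ.re) :
    Summable fun m : ℕ ↦ ‖(∑ n ∈ Icc 1 (m + 1), c n) *
      (((m : ℂ) + 1) ^ (-ρ) - ((m : ℂ) + 2) ^ (-ρ))‖ := by
  set B : ℝ := ∑ n ∈ Icc 1 L, ‖c n‖ with hB
  refine Summable.of_nonneg_of_le (fun m ↦ norm_nonneg _)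
    (fun m ↦ ?_) ((summable_nat_add_one_rpow_neg (q := ρ.re + 1) (by linarith)).mul_left (B * ‖ρ‖))
  rw [norm_mul]
  calc ‖∑ n ∈ Icc 1 (m + 1), c n‖ * ‖((m : ℂ) + 1) ^ (-ρ) - ((m : ℂ) + 2) ^ (-ρ)‖
      ≤ B * (‖ρ‖ * ((m : ℝ) + 1) ^ (-ρ.re - 1)) :=
        mul_le_mul (norm_partialSum_le hc _) (norm_cpow_succ_sub_le m hρ) (norm_nonneg _)
          (Finset.sum_nonneg fun n _ ↦ norm_nonneg _)
    _ = B * ‖ρ‖ * ((m : ℝ) + 1) ^ (-(ρ.re + 1)) := by rw [neg_add']; ring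

/-- `(K+1)^{-ρ} → 0` as `K → ∞` (`Re ρ > 0`). [folklore] -/
theorem tendsto_natCast_add_one_cpow_neg {ρ : ℂ} (hρ : 0 < ρ.re) :
    Tendsto (fun K : ℕ ↦ ((K : ℂ) + 1) ^ (-ρ)) atTop (𝓝 0) := by
  rw [tendsto_zero_iff_norm_tendsto_zero]
  have h1 : Tendsto (fun K : ℕ ↦ (K : ℝ) + 1) atTop atTop :=
    tendsto_atTop_add_const_right _ _ tendsto_natCast_atTop_atTop
  have h2 := (tendsto_rpow_neg_atTop hρ).comp h1
  refine h2.congr fun K ↦ ?_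
  have hK : (0 : ℝ) < (K : ℝ) + 1 := by positivity
  simp only [Function.comp_apply]
  rw [show ((K : ℂ) + 1) = (((K : ℝ) + 1 : ℝ) : ℂ) by push_cast; ring,
    Complex.norm_cpow_eq_rpow_re_of_pos hK, neg_re]

/-- **Evaluation identity (Abel summation).** If `c_n = 0` for `n > L` and `Re ρ > 0`, then
`Σ_{m ≥ 0} S_{m+1} ((m+1)^{-ρ} − (m+2)^{-ρ}) = Σ_{n∈[1,L]} c_n n^{-ρ} = D(ρ)`; equivalently
`⟨S, r_ρ⟩_{ℓ²(w)} = D(ρ)/ρ` for the representer `r_ρ(k) = k(k+1) conj(k^{-ρ} − (k+1)^{-ρ})/conj ρ`.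
[folklore] -/
theorem hasSum_eval {c : ℕ → ℂ} {L : ℕ} (hc : ∀ n, L < n → c n = 0) {ρ : ℂ} (hρ : 0 < ρ.re) :
    HasSum (fun m : ℕ ↦ (∑ n ∈ Icc 1 (m + 1), c n) *
        (((m : ℂ) + 1) ^ (-ρ) - ((m : ℂ) + 2) ^ (-ρ)))
      (∑ n ∈ Icc 1 L, c n * (n : ℂ) ^ (-ρ)) := by
  rw [hasSum_iff_tendsto_nat_of_summable_norm (summable_norm_abel_term hc hρ)]
  simp_rw [abel_range c ρ]
  have hlim : Tendsto (fun K : ℕ ↦ ∑ n ∈ Icc 1 L, c n * (n : ℂ) ^ (-ρ) -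
      (∑ n ∈ Icc 1 L, c n) * ((K : ℂ) + 1) ^ (-ρ)) atTop
      (𝓝 (∑ n ∈ Icc 1 L, c n * (n : ℂ) ^ (-ρ))) := by
    have h := (tendsto_natCast_add_one_cpow_neg hρ).const_mul (∑ n ∈ Icc 1 L, c n)
    rw [mul_zero] at h
    simpa using (tendsto_const_nhds (x := ∑ n ∈ Icc 1 L, c n * (n : ℂ) ^ (-ρ))).sub h
  refine hlim.congr' ?_
  filter_upwards [eventually_ge_atTop L] with K hK
  rw [dirichlet_eq_of_le hc hK, partialSum_eq_of_le hc hK]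

/-! ## §3 — The coefficients of `1 − ζ_M(s) A_a(s)` -/

/-- **Coefficients of `1 − ζ_M A_a`.** With
`c_n = [n = 1] − Σ_{m ≤ M} Σ_{j<N} [m(j+1) = n] a_j` one has, for every `s`,
`Σ_{n∈[1, MN+1]} c_n n^{-s} = 1 − ζ_M(s) · Σ_{j<N} a_j (j+1)^{-s}`. [folklore] -/
theorem section_coeff_sum_cpow (M N : ℕ) (a : Fin N → ℂ) (s : ℂ) :
    ∑ n ∈ Icc 1 (M * N + 1), ((if n = 1 then (1 : ℂ) else 0) -
        ∑ m ∈ Icc 1 M, ∑ j : Fin N, (if m * ((j : ℕ) + 1) = n then a j else 0)) *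
          (n : ℂ) ^ (-s) =
      1 - zetaPartialSum M s * ∑ j : Fin N, a j * ((j : ℂ) + 1) ^ (-s) := by
  have h1 : (1 : ℕ) ∈ Icc 1 (M * N + 1) := by rw [Finset.mem_Icc]; omega
  simp_rw [sub_mul, Finset.sum_sub_distrib]
  congr 1
  · simp_rw [ite_mul, zero_mul, one_mul]
    rw [Finset.sum_ite_eq' (Icc 1 (M * N + 1)) 1, if_pos h1]
    simp
  · simp_rw [Finset.sum_mul, ite_mul, zero_mul]
    rw [Finset.sum_comm]
    rw [zetaPartialSum, Finset.sum_mul]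
    refine Finset.sum_congr rfl fun m hm ↦ ?_
    rw [Finset.sum_comm, Finset.mul_sum]
    refine Finset.sum_congr rfl fun j _ ↦ ?_
    rw [Finset.mem_Icc] at hm
    have hmem : m * ((j : ℕ) + 1) ∈ Icc 1 (M * N + 1) := by
      rw [Finset.mem_Icc]
      constructor
      · exact Nat.mul_pos (by omega) (by omega)
      · have : (j : ℕ) + 1 ≤ N := j.isLt
        nlinarith
    rw [Finset.sum_ite_eq (Icc 1 (M * N + 1)) (m * ((j : ℕ) + 1)), if_pos hmem]
    have hcast : ((m * ((j : ℕ) + 1) : ℕ) : ℂ) = (m : ℂ) * ((j : ℂ) + 1) := by push_cast; ring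
    rw [hcast, show (m : ℂ) * ((j : ℂ) + 1) = (m : ℂ) * ((j + 1 : ℕ) : ℂ) by push_cast; ring,
      Complex.natCast_mul_natCast_cpow]
    push_cast
    ring

/-- The coefficients of `1 − ζ_M A_a` vanish beyond `M N + 1`. [folklore] -/
theorem section_coeff_eq_zero (M N : ℕ) (a : Fin N → ℂ) (n : ℕ) (hn : M * N + 1 < n) :
    ((if n = 1 then (1 : ℂ) else 0) -
        ∑ m ∈ Icc 1 M, ∑ j : Fin N, (if m * ((j : ℕ) + 1) = n then a j else 0)) = 0 := by
  rw [if_neg (by omega)]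
  rw [Finset.sum_eq_zero fun m hm ↦ ?_]
  · simp
  · refine Finset.sum_eq_zero fun j _ ↦ ?_
    rw [Finset.mem_Icc] at hm
    rw [if_neg]
    have : (j : ℕ) + 1 ≤ N := j.isLt
    intro h
    have : m * ((j : ℕ) + 1) ≤ M * N := Nat.mul_le_mul hm.2 this
    omega

end Summit.RiemannHypothesis.RiemannHypothesis.Theorems.NbSectionZeroLaw

end
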